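import Literature.Analysis.FluidPDE.CompressibleEulerImplosionMonatomicHolds
import Literature.Analysis.FluidPDE.CompressibleEulerImplosionRatesFromFacts
import HarnessLib

/-!
# Discharges of named facts of `CompressibleEulerImplosionRates.lean`

`Literature/Analysis/FluidPDE/CompressibleEulerImplosionRatesHolds.lean` — proofs-only sibling
of `CompressibleEulerImplosionRates.lean` (no definitions, no named facts). Each theorem below
closes a named fact `X : Prop` of that file as `X_holds : X` by composing an ACCEPTED
reduction theorem of the tree with the ACCEPTED unconditional `_holds` discharges of all of
its hypotheses; nothing is re-proved and no statement is changed. Recorded by the librarian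
sweep g25 (2026-08-16, pass 5c: facts dischargeable in one line from the tree's own lemmas),
so that the facts census, `#h21_route_deps` and the cone guardrail see these facts as
theorems.

Discharged here:

* `CaolaboraEtAl2025_thm12_rates_holds` := `rates_of_thm11_monatomic`
  `BuckmasterCaolaboraGomezserrano2025_thm11_monatomic_holds`
  (`CompressibleEulerImplosionRatesFromFacts.lean`).

## References

* [CaolaboraEtAl2025] — see `lean/references.bib` and the docstring of the fact in `CompressibleEulerImplosionRates.lean`.
-/

namespace Literature.Analysis.FluidPDE

/-- **Discharge of the named fact `CaolaboraEtAl2025_thm12_rates`**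
(`CompressibleEulerImplosionRates.lean`): NAMED FACT — the CGSS self-similar implosion of the
monatomic ideal gas on `𝕋³`, with its rates (Cao-Labora–Gómez-Serrano–Shi–Staffilani,
arXiv:2310.05325 = Camb. J. Math. 13 (2025)). Printed statements (pages of the held text).
Theorem 1.2, p. 6: … — obtained as `rates_of_thm11_monatomic` applied to the tree's
unconditional discharge `BuckmasterCaolaboraGomezserrano2025_thm11_monatomic_holds` of its
hypothesis (reduction in `CompressibleEulerImplosionRatesFromFacts.lean`).
[cite: CaolaboraEtAl2025, Thm 1.2 + Rem 1.4 + Rem 1.5 + Prop 3.3 + Lemmas 3.5-3.7 + (1.6)] -/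
theorem CaolaboraEtAl2025_thm12_rates_holds :
    CaolaboraEtAl2025_thm12_rates :=
  Literature.Analysis.FluidPDE.CaolaboraEtAl2025.rates_of_thm11_monatomic
    BuckmasterCaolaboraGomezserrano2025_thm11_monatomic_holds

end Literature.Analysis.FluidPDE
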